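import Literature.IUT.LogVolume.Xi3ModelWeightedWitness
import HarnessLib

/-!
# [IUTchIII] Remark 3.9.5 (iv) (Ξ3) with the WEIGHTED log-volume of Rmk. 3.1.1 (ii): `μ^log(P) < μ^log(H_Ξ(P))`
# and the printed existential (proof-only; part 2 of 2; abc-iut cell, layer L6)

Continuation of `Xi3ModelWeightedWitness.lean` (same hypotheses and witness).  Mochizuki, [IUTchIII] Rmk. 3.9.5
(iv) (Ξ3), kurims p. 129 l.8–11 [claim: Mochizuki2012, status: disputed].  PROVED here, in the weighted
projection reading `boxLogVolume K w` of `HullCaseModel.lean` / `Xi1Model.lean`: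
* the coordinate projections of `H_Ξ(P) = ⋃ Ξ(P)` are PINNED — `pr_{j₁} H_Ξ(P) = ϖ_{j₁}^{-a}𝒪_{j₁}` (it contains
  the `j₁`-factor of `H₁ ∈ Ξ(P)` and lies in that of `φ(P)`), `pr_j H_Ξ(P) = 𝒪_j` for `j ≠ j₁` (via `H₀ ∈ Ξ(P)`);
* hence **`μ^log(P) = 0 < w_{j₁}·a·log q_{j₁} = μ^log(H_Ξ(P))`** (`boxLogVolume_witness_lt_hXi`);
* the printed existential `exists_region_boxLogVolume_lt_hXi` — a direct product region `P` with two DISTINCT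
  `H₀ ≠ H₁ ∈ Ξ(P)`, `H₀` an additive-subgroup region with `μ^log(P) = μ^log(H₀)` ("the situation of (Ξ1^non)"),
  and `μ^log(P) < μ^log(H_Ξ(P))`; instantiated at equal residue cardinalities with a constant weight
  (`…_of_residueCard_eq`, the printed example's shape in any number `≥ 2` of coordinates) and at the printed
  normalised weights `w_j = c/N_j` with all residue fields `𝔽_p` (`…_div_weights`, `a = N_{j₁}`, `b = N_{j₂}`).
HONEST SCOPE: on NON-product regions the weighted `μ^log` is the projection reading (an upper bound for the
weighted measure of Rmk. 3.1.1 (iv)); the kernel of the printed claim — two distinct members of `Ξ(P)` of the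
log-volume of `P` — is part 1 and does not depend on that reading; the equal-weight measure version is
abc-iut-L6-t4's p444370.  No definitions; no side taken on [IUTchIII] Cor. 3.12.
-/

noncomputable section

open MeasureTheory MeasureTheory.Measure Set Metric TopologicalSpace Bornology Filter
open scoped ENNReal NNReal Pointwise NormedField Topology
open Literature.NumberTheory.GaloisRepresentations.Ultrametric

namespace Literature.IUT.LogVolume

namespace Xi3Weighted

variable {J : Type*} [Fintype J] [DecidableEq J] (K : J → Type*) [∀ j, NontriviallyNormedField (K j)]
  [∀ j, IsUltrametricDist (K j)] [∀ j, ProperSpace (K j)] [∀ j, MeasurableSpace (K j)]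
  [∀ j, BorelSpace (K j)]

section Witness

variable {K}
variable (w : J → ℝ) {j₁ j₂ : J} (hj : j₁ ≠ j₂) {ϖ₁ : (K j₁)ˣ} (hϖ₁ : IsUniformizer ϖ₁)
  {ϖ₂ : (K j₂)ˣ} (hϖ₂ : IsUniformizer ϖ₂) (a b : ℕ)

/-! ### The projections of `H_Ξ(P)` are pinned; `μ^log(P) < μ^log(H_Ξ(P))` -/

include hj hϖ₁ hϖ₂ in
/-- The `j₁`-th coordinate projection of `H_Ξ(P)` is PINNED to `ϖ_{j₁}^{-a}𝒪_{j₁}`: it contains the `j₁`-factor of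
`H₁ ∈ Ξ(P)` and is contained in the `j₁`-factor of `φ(P)`. [cite: Mochizuki2012, IUTchIII Rmk. 3.9.5 (iii) p. 128] -/
theorem boxFactor_hXi_witness_fst
    (hcomm : w j₁ * (a * Real.log (residueCard (K j₁))) = w j₂ * (b * Real.log (residueCard (K j₂)))) :
    boxFactor K (LogThetaLattice.HXi (hullSets K) (holomorphicHull K) (boxLogVolume K w)
        (Set.pi univ fun j => closedBall (0 : K j) 1 ∪
          {Function.update (0 : Π j, K j) j₁ (((ϖ₁⁻¹ ^ a : (K j₁)ˣ)) : K j₁) j})) j₁ =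
      closedBall (0 : K j₁) ‖((ϖ₁⁻¹ ^ a : (K j₁)ˣ) : K j₁)‖ := by
  obtain ⟨c, hc, hφ⟩ := holomorphicHull_pi_eq_hullSet K
    (isDirectProductRegion_unitBall_union_singleton K
      (Function.update (0 : Π j, K j) j₁ (((ϖ₁⁻¹ ^ a : (K j₁)ˣ)) : K j₁)))
  obtain ⟨h1, -⟩ := norm_hullRadii_witness hϖ₁ a hc
  apply Subset.antisymm
  · -- `⊆`: `H_Ξ(P) ⊆ φ(P) = λ·𝒪` with `‖λ_{j₁}‖ = ‖ϖ^{-a}‖`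
    rintro _ ⟨u, hu, rfl⟩
    have huφ : u ∈ holomorphicHull K _ :=
      (LogThetaLattice.hXi_subset_hPhi_subset (hullSets K) (holomorphicHull K) (boxLogVolume K w) _).2
        ((LogThetaLattice.hXi_subset_hPhi_subset (hullSets K) (holomorphicHull K) (boxLogVolume K w) _).1 hu)
    rw [hφ] at huφ
    have := (mem_polydisc K).mp huφ j₁
    rw [h1] at this
    exact mem_closedBall_zero_iff.mpr this
  · -- `⊇`: the `j₁`-factor of `H₁ ∈ Ξ(P)`
    intro y hy
    have hH₁ := tiltedHull_mem_xiApprox_witness w hj hϖ₁ hϖ₂ a b hcomm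
    set d : Π j, (K j)ˣ := Function.update (Function.update (1 : Π j, (K j)ˣ) j₂ (ϖ₂ ^ b)) j₁ (ϖ₁⁻¹ ^ a)
      with hd
    -- the point of `H₁` with `j₁`-coordinate `y` and the other coordinates `0`
    refine ⟨Function.update (0 : Π j, K j) j₁ y, Set.subset_sUnion_of_mem hH₁ ?_, by simp⟩
    rw [show hullSet K (fun j => ((d j : (K j)ˣ) : K j)) = polydisc K (fun j => ‖((d j : (K j)ˣ) : K j)‖)
      from rfl, mem_polydisc]
    intro j
    by_cases hj₁ : j = j₁
    · subst hj₁
      rw [Function.update_self, hd, tilt_apply_fst]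
      exact mem_closedBall_zero_iff.mp hy
    · rw [Function.update_of_ne hj₁, Pi.zero_apply, norm_zero]
      exact norm_nonneg _

include hϖ₁ in
/-- For `j ≠ j₁` the `j`-th projection of `H_Ξ(P)` is PINNED to `𝒪_j` (it contains the `j`-factor of
`H₀ ∈ Ξ(P)` and lies in the `j`-factor of `φ(P)`). [cite: Mochizuki2012, IUTchIII Rmk. 3.9.5 (iii) p. 128] -/
theorem boxFactor_hXi_witness_of_ne {j : J} (hne : j ≠ j₁) :
    boxFactor K (LogThetaLattice.HXi (hullSets K) (holomorphicHull K) (boxLogVolume K w)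
        (Set.pi univ fun j => closedBall (0 : K j) 1 ∪
          {Function.update (0 : Π j, K j) j₁ (((ϖ₁⁻¹ ^ a : (K j₁)ˣ)) : K j₁) j})) j =
      closedBall (0 : K j) 1 := by
  obtain ⟨c, hc, hφ⟩ := holomorphicHull_pi_eq_hullSet K
    (isDirectProductRegion_unitBall_union_singleton K
      (Function.update (0 : Π j, K j) j₁ (((ϖ₁⁻¹ ^ a : (K j₁)ˣ)) : K j₁)))
  obtain ⟨-, hrest⟩ := norm_hullRadii_witness hϖ₁ a hc
  apply Subset.antisymm
  · rintro _ ⟨u, hu, rfl⟩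
    have huφ : u ∈ holomorphicHull K _ :=
      (LogThetaLattice.hXi_subset_hPhi_subset (hullSets K) (holomorphicHull K) (boxLogVolume K w) _).2
        ((LogThetaLattice.hXi_subset_hPhi_subset (hullSets K) (holomorphicHull K) (boxLogVolume K w) _).1 hu)
    rw [hφ] at huφ
    have := (mem_polydisc K).mp huφ j
    rw [hrest j hne] at this
    exact mem_closedBall_zero_iff.mpr this
  · intro y hy
    have hH₀ := unitHull_mem_xiApprox_witness w hϖ₁ a
    refine ⟨Function.update (0 : Π j, K j) j y, Set.subset_sUnion_of_mem hH₀ ?_, by simp⟩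
    rw [show hullSet K (fun j => ((1 : (K j)ˣ) : K j)) = polydisc K (fun j => ‖((1 : (K j)ˣ) : K j)‖)
      from rfl, mem_polydisc]
    intro i
    rw [Units.val_one, norm_one]
    by_cases hij : i = j
    · subst hij
      rw [Function.update_self]
      exact mem_closedBall_zero_iff.mp hy
    · rw [Function.update_of_ne hij, Pi.zero_apply, norm_zero]
      exact zero_le_one

include hj hϖ₁ hϖ₂ in
/-- **`μ^log(H_Ξ(P)) = w_{j₁}·a·log q_{j₁}`** (projection reading of Rmk. 3.1.1 (iii) at the pinned factors).
[cite: Mochizuki2012, IUTchIII Rmk. 3.9.5 (iv) p. 129] -/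
theorem boxLogVolume_hXi_witness
    (hcomm : w j₁ * (a * Real.log (residueCard (K j₁))) = w j₂ * (b * Real.log (residueCard (K j₂)))) :
    boxLogVolume K w (LogThetaLattice.HXi (hullSets K) (holomorphicHull K) (boxLogVolume K w)
        (Set.pi univ fun j => closedBall (0 : K j) 1 ∪
          {Function.update (0 : Π j, K j) j₁ (((ϖ₁⁻¹ ^ a : (K j₁)ˣ)) : K j₁) j})) =
      w j₁ * (a * Real.log (residueCard (K j₁))) := by
  rw [boxLogVolume_eq_sum]
  have hterm : ∀ j, w j * (unitBallStructure (K j)).logVolume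
      (boxFactor K (LogThetaLattice.HXi (hullSets K) (holomorphicHull K) (boxLogVolume K w)
        (Set.pi univ fun j => closedBall (0 : K j) 1 ∪
          {Function.update (0 : Π j, K j) j₁ (((ϖ₁⁻¹ ^ a : (K j₁)ˣ)) : K j₁) j})) j) =
      if j = j₁ then w j₁ * (a * Real.log (residueCard (K j₁))) else 0 := by
    intro j
    by_cases hj₁ : j = j₁
    · subst hj₁
      rw [if_pos rfl, boxFactor_hXi_witness_fst w hj hϖ₁ hϖ₂ a b hcomm, norm_inv_pow_eq_zpow]
      change w j * localLogVolume (K j) _ = _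
      rw [localLogVolume_closedBall_zpow (K j) hϖ₁]
      push_cast
      ring
    · rw [if_neg hj₁, boxFactor_hXi_witness_of_ne w hϖ₁ a hj₁]
      change w j * localLogVolume (K j) _ = 0
      rw [localLogVolume_closedBall_one, mul_zero]
  rw [Finset.sum_congr rfl fun j _ => hterm j, Finset.sum_ite_eq' Finset.univ j₁]
  simp

include hj hϖ₁ hϖ₂ in
/-- **(Ξ3) at the witness**: `μ^log(P) = 0 < w_{j₁}·a·log q_{j₁} = μ^log(H_Ξ(P))` for `a ≥ 1`, `w_{j₁} > 0`.
[cite: Mochizuki2012, IUTchIII Rmk. 3.9.5 (iv) p. 129] -/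
theorem boxLogVolume_witness_lt_hXi (hw : 0 < w j₁) (ha : 0 < a)
    (hcomm : w j₁ * (a * Real.log (residueCard (K j₁))) = w j₂ * (b * Real.log (residueCard (K j₂)))) :
    boxLogVolume K w (Set.pi univ fun j => closedBall (0 : K j) 1 ∪
        {Function.update (0 : Π j, K j) j₁ (((ϖ₁⁻¹ ^ a : (K j₁)ˣ)) : K j₁) j}) <
      boxLogVolume K w (LogThetaLattice.HXi (hullSets K) (holomorphicHull K) (boxLogVolume K w)
        (Set.pi univ fun j => closedBall (0 : K j) 1 ∪
          {Function.update (0 : Π j, K j) j₁ (((ϖ₁⁻¹ ^ a : (K j₁)ˣ)) : K j₁) j})) := by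
  rw [boxLogVolume_pi_unitBall_union_singleton, boxLogVolume_hXi_witness w hj hϖ₁ hϖ₂ a b hcomm]
  have hq : 0 < Real.log (residueCard (K j₁)) := Real.log_pos (one_lt_residueCard_real (K j₁))
  have ha' : (0 : ℝ) < a := by exact_mod_cast ha
  positivity

end Witness

/-! ### The printed existential, and its instantiations -/

/-- **[IUTchIII] Rmk 3.9.5 (iv) (Ξ3) IN GENERAL**: in `⊕_j K_j` with at least two coordinates `j₁ ≠ j₂`, a
positive weight at `j₁`, and COMMENSURABLE weighted residue logarithms at `j₁`, `j₂` (`w_{j₁}·a·log q_{j₁} =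
w_{j₂}·b·log q_{j₂}`, `a ≥ 1`), there is a direct product region `P` with two DISTINCT hull-approximants of equal
log-volume `H₀ ≠ H₁ ∈ Ξ(P)` — `H₀ = Π 𝒪_j` an additive-subgroup region with `μ^log(P) = μ^log(H₀)` (the situation
of (Ξ1^non)) — and `μ^log(P) < μ^log(H_Ξ(P))`. [cite: Mochizuki2012, IUTchIII Rmk. 3.9.5 (iv) p. 129] -/
theorem exists_region_boxLogVolume_lt_hXi (w : J → ℝ) {j₁ j₂ : J} (hj : j₁ ≠ j₂) (hw : 0 < w j₁)
    {a b : ℕ} (ha : 0 < a)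
    (hcomm : w j₁ * (a * Real.log (residueCard (K j₁))) = w j₂ * (b * Real.log (residueCard (K j₂)))) :
    ∃ P ∈ directProductRegions K,
      ∃ H₀ ∈ LogThetaLattice.XiApprox (hullSets K) (holomorphicHull K) (boxLogVolume K w) P,
      ∃ H₁ ∈ LogThetaLattice.XiApprox (hullSets K) (holomorphicHull K) (boxLogVolume K w) P,
        H₀ ≠ H₁ ∧ (∃ G : AddSubgroup (Π j, K j), (G : Set (Π j, K j)) = H₀) ∧
        boxLogVolume K w P = boxLogVolume K w H₀ ∧
        boxLogVolume K w P <
          boxLogVolume K w (LogThetaLattice.HXi (hullSets K) (holomorphicHull K) (boxLogVolume K w) P) := by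
  obtain ⟨ϖ₁, hϖ₁⟩ := exists_isUniformizer (F := K j₁)
  obtain ⟨ϖ₂, hϖ₂⟩ := exists_isUniformizer (F := K j₂)
  refine ⟨_, ⟨_, rfl, isDirectProductRegion_unitBall_union_singleton K
      (Function.update (0 : Π j, K j) j₁ (((ϖ₁⁻¹ ^ a : (K j₁)ˣ)) : K j₁))⟩,
    _, unitHull_mem_xiApprox_witness w hϖ₁ a, _, tiltedHull_mem_xiApprox_witness w hj hϖ₁ hϖ₂ a b hcomm,
    unitHull_ne_tiltedHull hϖ₁ a b ha, ?_, ?_, boxLogVolume_witness_lt_hXi w hj hϖ₁ hϖ₂ a b hw ha hcomm⟩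
  · -- `H₀ = Π 𝒪_j` is (the carrier of) the additive subgroup `Π_j 𝒪_j`
    refine ⟨AddSubgroup.pi Set.univ fun j => (unitBallStructure (K j)).toOpenAddSubgroup.toAddSubgroup, ?_⟩
    rw [AddSubgroup.coe_pi]
    change (Set.pi univ fun j => ((unitBallStructure (K j)).toOpenAddSubgroup.toAddSubgroup : Set (K j))) =
      polydisc K (fun j => ‖((1 : (K j)ˣ) : K j)‖)
    unfold polydisc
    congr 1
    funext j
    change ((unitBallStructure (K j)).toOpenAddSubgroup : Set (K j)) = closedBall 0 ‖((1 : (K j)ˣ) : K j)‖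
    rw [Units.val_one, norm_one]
    exact coe_unitBallStructure (K j)
  · rw [boxLogVolume_pi_unitBall_union_singleton, boxLogVolume_unitHull]

/-- **(Ξ3), equal residue cardinalities and equal weights** — the shape of the printed example
(`ℚ_p × ℚ_p`, `a = b = 1`) in ANY number `≥ 2` of coordinates: `q_{j₁} = q_{j₂}` and a constant positive weight.
[cite: Mochizuki2012, IUTchIII Rmk. 3.9.5 (iv) p. 129] -/
theorem exists_region_boxLogVolume_lt_hXi_of_residueCard_eq {c : ℝ} (hc : 0 < c) {j₁ j₂ : J} (hj : j₁ ≠ j₂)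
    (hq : residueCard (K j₁) = residueCard (K j₂)) :
    ∃ P ∈ directProductRegions K,
      ∃ H₀ ∈ LogThetaLattice.XiApprox (hullSets K) (holomorphicHull K) (boxLogVolume K fun _ => c) P,
      ∃ H₁ ∈ LogThetaLattice.XiApprox (hullSets K) (holomorphicHull K) (boxLogVolume K fun _ => c) P,
        H₀ ≠ H₁ ∧ (∃ G : AddSubgroup (Π j, K j), (G : Set (Π j, K j)) = H₀) ∧
        boxLogVolume K (fun _ => c) P = boxLogVolume K (fun _ => c) H₀ ∧
        boxLogVolume K (fun _ => c) P <
          boxLogVolume K (fun _ => c)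
            (LogThetaLattice.HXi (hullSets K) (holomorphicHull K) (boxLogVolume K fun _ => c) P) :=
  exists_region_boxLogVolume_lt_hXi K (fun _ => c) hj hc (a := 1) (b := 1) one_pos (by rw [hq])

/-- **(Ξ3) in the situation of (Ξ1^non) with the printed normalised weights**: all residue fields `= 𝔽_p`
(residue degree `1` at every valuation over `v_ℚ`) and `w_j = c/N_j` ([IUTchIII] Rmk. 3.1.1 (ii), `N_j ≥ 1`):
take `a = N_{j₁}`, `b = N_{j₂}`. [cite: Mochizuki2012, IUTchIII Rmk. 3.9.5 (iv) p. 129]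
[cite: Mochizuki2012, IUTchIII Rmk. 3.1.1 (ii) p. 94] -/
theorem exists_region_boxLogVolume_lt_hXi_div_weights {c : ℝ} (hc : 0 < c) {N : J → ℕ} (hN : ∀ j, 0 < N j)
    {p : ℕ} (hres : ∀ j, residueCard (K j) = p) {j₁ j₂ : J} (hj : j₁ ≠ j₂) :
    ∃ P ∈ directProductRegions K,
      ∃ H₀ ∈ LogThetaLattice.XiApprox (hullSets K) (holomorphicHull K) (boxLogVolume K fun j => c / N j) P,
      ∃ H₁ ∈ LogThetaLattice.XiApprox (hullSets K) (holomorphicHull K) (boxLogVolume K fun j => c / N j) P,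
        H₀ ≠ H₁ ∧ (∃ G : AddSubgroup (Π j, K j), (G : Set (Π j, K j)) = H₀) ∧
        boxLogVolume K (fun j => c / N j) P = boxLogVolume K (fun j => c / N j) H₀ ∧
        boxLogVolume K (fun j => c / N j) P <
          boxLogVolume K (fun j => c / N j)
            (LogThetaLattice.HXi (hullSets K) (holomorphicHull K) (boxLogVolume K fun j => c / N j) P) := by
  have hN₁ : (0 : ℝ) < N j₁ := by exact_mod_cast hN j₁
  have hN₂ : (N j₂ : ℝ) ≠ 0 := by exact_mod_cast (hN j₂).ne'
  refine exists_region_boxLogVolume_lt_hXi K (fun j => c / N j) hj (div_pos hc hN₁) (a := N j₁) (b := N j₂)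
    (hN j₁) ?_
  rw [hres j₁, hres j₂]
  field_simp

end Xi3Weighted

end Literature.IUT.LogVolume

end
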